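import Summits.HubbardSuperconductivity.HubbardSuperconductivity.Theorems.DeformationLadderLadderThesisPinnedFrameBloch
import Summits.HubbardSuperconductivity.HubbardSuperconductivity.Theorems.TwistGapTgCondensationOfRigidity
import HarnessLib

/-!
# Skeleton — crux `LadderThesis` (stmt-HubbardSuperconductivity-1890), line `Sketch`
# (card `pinned-up-gauge-frame`, `Cruxes/LadderThesis/SketchIdeator2.lean`)

The card's **Transfer**: `C⁺ := CondensateBloch ∧ TgLowEnergyCondensation (K = 1) ⇒ LadderThesis`
("conjugate `CondensateBloch` by `D_{k₁}` (Covariance + TwistIsospectral) to get single-mode rigidity at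
`±k₁, ±k₂`, feed TwistGap's `TgCruxGlue` to get `TgThesis`, which is `LowEnergyRigidity` and hence
`LadderThesis`").  The sketch's algebraic companions (`Covariance`, `PairFieldAtZero`, `OrbitSumRule`,
`TwistIsospectral`, `FramePinningImpliesLadder`) are landed (p92152, p92715, p93291, p93488, p93697), so the
line's open content is exactly the three stubs below:

* `stub_condensateBloch` — the sketch's `CondensateBloch`, transcribed into tree vocabulary: the sketch's
  `upTwist L k = orbitalPhase (e^{-iθ_k} on ↑, 1 on ↓)` is the tree's `fockTwist (-(upTwistAngle L k))`
  (`PinnedFrameDefs`, `cexp_neg_upTwistAngle_orb_up`), its `kOne = (1,0)` is `Pi.single 0 1`, and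
  `(upTwist L k₁)ᴴ * H * upTwist L k₁` is kept literally as `Uᴴ * H * U`;
* `stub_lowEnergyCondensation` — TwistGap's crux `TgLowEnergyCondensation` (stmt-1510) verbatim (the card asks
  for its `K = 1` instance; the route decl is existential in `K`, which is weaker, so this is the card's
  conjunct up to that slack);
* `stub_transfer` — the card's Transfer `C⁺ ⇒ LadderThesis`.

`LadderThesis_of` composes them and concludes the crux BY NAME.

**Cycle 1 (2026-08-16).** `stub_condensateBloch` is LANDED (p96131,
`Theorems/DeformationLadderLadderThesisStubCondensateBloch.lean`) — and it is vacuous: `γ := σ/32`, `L₀ := 0`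
witness it for every `U, δ, L, φ`, because the right-hand side telescopes to `Re⟨D_{k₁}φ, H D_{k₁}φ⟩ - E₀ ≥ 0`
(Bloch) while `L⁻⁴ Re⟨Δ_dᴴΔ_d⟩_φ ≤ 32`.  Consequently (`transferStatement_iff` below, no `sorry`) the transfer
stub is equivalent to `TgLowEnergyCondensation → LadderThesis`, and since the tree already proves
`LadderThesis → TgLowEnergyCondensation` (`ladderThesis_iff_tgThesis`, `tgLowEnergyCondensation_of_tgThesis`)
the line's remaining content is exactly "TwistGap's condensation crux (stmt-1510) ALONE is equivalent to
`LadderThesis ≡ TgThesis ≡ LowEnergyRigidity`", i.e. the zero-momentum selection / pair-stiffness half that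
TwistGap isolates as its crux `TgPairMomentumRigidity` (stmt-1509).  No stub of this line is both non-vacuous
and not an existing open crux of route TwistGap: see `Lines/Sketch.dead.md`.
-/

noncomputable section

namespace Summit.HubbardSuperconductivity.HubbardSuperconductivity.Theorems.DeformationLadder.PinnedFrameLine

set_option linter.dupNamespace false

open Matrix Complex Literature.MathematicalPhysics.QuantumLattice Literature.Probability.LatticeModels
open Summit.HubbardSuperconductivity.HubbardSuperconductivity.Theses.DeformationLadder
open Summit.HubbardSuperconductivity.HubbardSuperconductivity.Theses.TwistGap (TgLowEnergyCondensation)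
open Summit.HubbardSuperconductivity.HubbardSuperconductivity.Theorems.PinnedFrame (upTwistAngle)

/-! ### Stub 1 — CLOSED (landed p96131 as `Theorems/DeformationLadderLadderThesisStubCondensateBloch.lean`,
same namespace and name; the proof is repeated here verbatim so that this workfile elaborates without importing
that module — replace this block by the import once convenient). -/

/-- Bloch's variational twist inequality, conjugate-frame form: `E₀ ≤ Re⟨ψ, Vᴴ H V ψ⟩` for `V = fockTwist θ`
and every unit sector vector `ψ`. Bohm (1949); Lieb–Schultz–Mattis (1961) App. B. [folklore] -/
theorem minEnergyOn_le_re_conjTranspose_frame (L : ℕ) (U : ℝ) (θ : Orb (FermionTorus 2 L) → ℝ)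
    {N : ℕ} {M : ℝ} {ψ : Fock (Orb (FermionTorus 2 L))} (hψ : ψ ∈ szSector N M)
    (hψ1 : star ψ ⬝ᵥ ψ = 1) :
    (hubbardTorus 2 L 1 U).minEnergyOn (szSector N M) ≤
      (star ψ ⬝ᵥ (((fockTwist θ)ᴴ * hubbardTorus 2 L 1 U * fockTwist θ) *ᵥ ψ)).re := by
  have hmem : fockTwist θ *ᵥ ψ ∈ szSector N M := PinnedFrame.fockTwist_mulVec_mem_szSector _ hψ
  have h1 : star (fockTwist θ *ᵥ ψ) ⬝ᵥ (fockTwist θ *ᵥ ψ) = 1 := by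
    rw [PinnedFrame.star_mulVec_dotProduct, conjTranspose_fockTwist_mulVec_mulVec, hψ1]
  have h := minEnergyOn_le_rayleigh_of_mem
    (LiebThm1.hamiltonian_isHermitian (fermionTorusGraph 2 L) 1 U) _ hmem h1
  rwa [Matrix.star_mulVec_dotProduct_mulVec] at h

/-- **Stub 1 — the card's `CondensateBloch` in tree vocabulary — PROVED (vacuously: `γ := σ/32`, `L₀ := 0`).**
Landed as p96131. [folklore] -/
theorem stub_condensateBloch :
    ∀ (U : ℝ), 0 < U → ∀ δ ∈ Set.Ioo (0:ℝ) (1 / 2), ∀ σ : ℝ, 0 < σ → ∃ γ : ℝ, 0 < γ ∧ ∃ L₀ : ℕ,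
      ∀ (L : ℕ) [NeZero L], L₀ ≤ L → Even L →
        ∀ φ : Fock (Orb (FermionTorus 2 L)),
          φ ∈ szSector (2 * ⌊(1 - δ) * (L : ℝ) ^ 2 / 2⌋₊) 0 → star φ ⬝ᵥ φ = 1 →
            γ * ((expect ((pairField dWaveFormFactor L)ᴴ * pairField dWaveFormFactor L) φ).re /
                (L : ℝ) ^ 4) - σ ≤
              ((expect (hubbardTorus 2 L 1 U) φ).re -
                  (hubbardTorus 2 L 1 U).minEnergyOn (szSector (2 * ⌊(1 - δ) * (L : ℝ) ^ 2 / 2⌋₊) 0)) +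
                (expect ((fockTwist (-(upTwistAngle L (Pi.single 0 1))))ᴴ * hubbardTorus 2 L 1 U *
                    fockTwist (-(upTwistAngle L (Pi.single 0 1))) - hubbardTorus 2 L 1 U) φ).re := by
  intro U _hU δ _hδ σ hσ
  refine ⟨σ / 32, by positivity, 0, ?_⟩
  intro L _ _hL _hE φ hφ hφ1
  have hL0 : (0 : ℝ) < L := Nat.cast_pos.mpr (Nat.pos_of_ne_zero (NeZero.ne L))
  have hL4 : (0 : ℝ) < (L : ℝ) ^ 4 := by positivity
  have hlro : (expect ((pairField dWaveFormFactor L)ᴴ * pairField dWaveFormFactor L) φ).re /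
      (L : ℝ) ^ 4 ≤ 32 := by
    rw [div_le_iff₀ hL4]
    exact DeformationLadder.re_expect_pairPenalty_le L hφ1
  have hframe := minEnergyOn_le_re_conjTranspose_frame L U (-(upTwistAngle L (Pi.single 0 1))) hφ hφ1
  have hexp : (expect ((fockTwist (-(upTwistAngle L (Pi.single 0 1))))ᴴ * hubbardTorus 2 L 1 U *
        fockTwist (-(upTwistAngle L (Pi.single 0 1))) - hubbardTorus 2 L 1 U) φ).re =
      (star φ ⬝ᵥ (((fockTwist (-(upTwistAngle L (Pi.single 0 1))))ᴴ * hubbardTorus 2 L 1 U *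
        fockTwist (-(upTwistAngle L (Pi.single 0 1)))) *ᵥ φ)).re - (expect (hubbardTorus 2 L 1 U) φ).re := by
    simp only [expect, sub_mulVec, dotProduct_sub, Complex.sub_re]
  rw [hexp]
  have hγ : σ / 32 * ((expect ((pairField dWaveFormFactor L)ᴴ * pairField dWaveFormFactor L) φ).re /
      (L : ℝ) ^ 4) ≤ σ / 32 * 32 := mul_le_mul_of_nonneg_left hlro (by positivity)
  linarith

/-- **Stub 2 — TwistGap's condensation crux** `TgLowEnergyCondensation` (item stmt-HubbardSuperconductivity-1510),
the second conjunct of the card's `C⁺`, verbatim. -/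
theorem stub_lowEnergyCondensation : TgLowEnergyCondensation := by
  sorry

/-- **The card's Transfer, as a named proposition** (so that the skeleton's only theorem concluding the
crux is `LadderThesis_of`): `C⁺ := CondensateBloch ∧ TgLowEnergyCondensation ⇒ LadderThesis`
(conjugation by `D_{k₁}`, TwistGap's `TgCruxGlue`, `ladderThesis_iff_tgThesis`). -/
def TransferStatement : Prop :=
    (∀ (U : ℝ), 0 < U → ∀ δ ∈ Set.Ioo (0:ℝ) (1 / 2), ∀ σ : ℝ, 0 < σ → ∃ γ : ℝ, 0 < γ ∧ ∃ L₀ : ℕ,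
      ∀ (L : ℕ) [NeZero L], L₀ ≤ L → Even L →
        ∀ φ : Fock (Orb (FermionTorus 2 L)),
          φ ∈ szSector (2 * ⌊(1 - δ) * (L : ℝ) ^ 2 / 2⌋₊) 0 → star φ ⬝ᵥ φ = 1 →
            γ * ((expect ((pairField dWaveFormFactor L)ᴴ * pairField dWaveFormFactor L) φ).re /
                (L : ℝ) ^ 4) - σ ≤
              ((expect (hubbardTorus 2 L 1 U) φ).re -
                  (hubbardTorus 2 L 1 U).minEnergyOn (szSector (2 * ⌊(1 - δ) * (L : ℝ) ^ 2 / 2⌋₊) 0)) +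
                (expect ((fockTwist (-(upTwistAngle L (Pi.single 0 1))))ᴴ * hubbardTorus 2 L 1 U *
                    fockTwist (-(upTwistAngle L (Pi.single 0 1))) - hubbardTorus 2 L 1 U) φ).re) →
    TgLowEnergyCondensation → LadderThesis

/-- **Stub 3 — the card's Transfer** `C⁺ ⇒ LadderThesis`. -/
theorem stub_transfer : TransferStatement := by
  sorry

/-- **What the transfer stub really says.** Because stub 1 is a theorem (and vacuous), the card's Transfer is
equivalent to `TgLowEnergyCondensation → LadderThesis`: TwistGap's condensation crux (stmt-1510) alone would
have to give the crux.  [folklore] -/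
theorem transferStatement_iff : TransferStatement ↔ (TgLowEnergyCondensation → LadderThesis) :=
  ⟨fun h => h stub_condensateBloch, fun h _ => h⟩

/-- **… and the converse is already in the tree**: `LadderThesis → TgLowEnergyCondensation`
(`ladderThesis_iff_tgThesis`, p89166; `tgLowEnergyCondensation_of_tgThesis`).  So the transfer stub would make
stmt-1510 EQUIVALENT to `LadderThesis ≡ TgThesis ≡ LowEnergyRigidity`, absorbing TwistGap's stiffness crux
stmt-1509 — the zero-momentum selection this line was supposed to supply through `CondensateBloch`. [folklore] -/
theorem tgLowEnergyCondensation_of_ladderThesis (h : LadderThesis) : TgLowEnergyCondensation :=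
  TwistGap.tgLowEnergyCondensation_of_tgThesis (ladderThesis_iff_tgThesis.mp h)

/-- **Composition**: the three stubs give the crux `LadderThesis` by name. -/
theorem LadderThesis_of : LadderThesis := by
  have h := stub_transfer
  unfold TransferStatement at h
  exact h stub_condensateBloch stub_lowEnergyCondensation

end Summit.HubbardSuperconductivity.HubbardSuperconductivity.Theorems.DeformationLadder.PinnedFrameLine
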